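import Mathlib
import Summits.Ventures.PercRepro2.HCov
import Summits.Ventures.PercRepro2.HCovSwap
import Summits.Ventures.PercRepro2.BHKEvents
import Summits.Ventures.PercRepro2.ExploreA3
import Summits.Ventures.PercRepro2.RootLeafUSigns
import Summits.Ventures.PercRepro2.RootLeafUTheorem

/-!
# A ROOT as a leaf at an UNMARKED vertex `u`, part 4: the second coefficient reduced to `X5 ≥ 0`
(blind cell PercRepro2, p4 g4; S3 (G4-u) v35, proofs/P4-G4U-T2.md)

The instance `a₁ := u` on `G − a₁` (roots `u, a₂`; `L = C(u)`, `K = C(a₂)`, `Q = {u ↮ a₂}`) carries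
four ATOMS, polynomial in its twelve masses (`Z = P(Q)`, `D = P(PD)`, `Do = P(PD, o ∈ U)`, `gap`):
* `ℋ = DEF + Z·Do` (`Hh`) — the cleared margin of the ROOT-SWAPPED instance, so `0 ≤ ℋ` by
  `margin_nonneg` (`Hh_nonneg`);
* `ℰ = ∂Gc/∂Do − gap·D` (`Ee`) — `= 2·[C_Q(b ∈ L, c ∈ L) − C_Q(b ∈ K, c ∈ L) + Z·P(PD, b ∈ L)] ≥ 0`
  by BHK06 Thm 1.3 (`bhk_same_cluster_events`) and Thm 1.4 (`bhk_cross_cluster`) (`Ee_nonneg`);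
* `𝒟 = ∂Gc/∂D + gap·Do` (`Dd`) — UNSIGNED; `𝒞 = ∂Gc/∂PQ − gap·Do` (`Cc`).

With the one-root masses `hb = P(b ∈ K)`, `d0 = P(c ∉ K)`, `e0 = P(o ∈ K, c ∉ K)`:
* `Gc(a₁ := u) = Z·𝒞 + gap·ℋ = D·𝒟 + Do·ℰ` (`Gc_eq_Cc_Hh`, `Gc_eq_Dd_Ee`, Euler in slots 1 / 2);
* **`T2 = 𝒞 + hb·ℋ + d0·𝒟 + e0·ℰ`** (`T2_eq_atoms`) — the second Bernstein coefficient is the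
  one-root vector `(1, hb, d0, e0)` paired with the atoms;
* hence **`Z·T2 = Gc(a₁ := u) + X5`** with `X5 := Z·(d0·𝒟 + e0·ℰ) + ℋ·(Z·hb − gap)`
  (`Z_mul_T2_eq`), where `0 ≤ Z·hb − gap` is Harris (`Zhb_sub_gap_nonneg`).

So **`0 ≤ X5 → HCov(a₁ := u) → 0 ≤ T2`** (`T2_nonneg_of_X5`; the degenerate `Z = 0` is
`T2_eq_zero_of_Z_eq_zero`), and the class (G4-u) is reduced to the sign `0 ≤ X5`, a statement
WITHOUT the induction term (`HCov_root_leaf_u_of_X5`). As a by-product `Gc(a₁ := u) ≤ T2`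
(`Gc_le_T2_of_X5`, the coefficientwise (THIN)).
-/

namespace Summit.Ventures.PercRepro2

open UnionCluster CovForm PendantRoot

namespace RootLeafU

variable {V : Type*} {E : Type*} [Fintype E] [DecidableEq E] [Fintype V] [DecidableEq V]
  {R : Type*} [Field R] [LinearOrder R] [IsStrictOrderedRing R]

section Atoms

variable (p : E → R) (ends : E → Sym2 V) (o a₂ c b u : V)

/-- `ℋ = DEF + P(Q)·Do` at the instance `a₁ := u` (the cleared margin of the root-swapped instance). -/
noncomputable def Hh : R :=
  DEF p ends o u a₂ c + prob p (avoidAll ends a₂ {u}) * Do p ends o u a₂ c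

/-- `ℰ = ∂Gc/∂Do − gap·D` at the instance `a₁ := u`. -/
noncomputable def Ee : R :=
  prob p (avoidAll ends a₂ {u}) * (EQb3 p ends u a₂ c b + PDb p ends u a₂ c b) +
    gap p ends u a₂ b * EQ3 p ends u a₂ c - gap p ends u a₂ b * prob p (PDEvent ends u a₂ c)

/-- `𝒟 = ∂Gc/∂D + gap·Do` at the instance `a₁ := u` (the unsigned atom). -/
noncomputable def Dd : R :=
  prob p (avoidAll ends a₂ {u}) *
      (EQbo p ends o u a₂ b - EQb3o p ends o u a₂ c b - PDbo p ends o u a₂ c b) +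
    gap p ends u a₂ b * (EQo p ends o u a₂ - EQ3o p ends o u a₂ c) +
    gap p ends u a₂ b * Do p ends o u a₂ c

/-- `𝒞 = ∂Gc/∂PQ − gap·Do` at the instance `a₁ := u`. -/
noncomputable def Cc : R :=
  prob p (PDEvent ends u a₂ c) * EQbo p ends o u a₂ b + Do p ends o u a₂ c * EQb3 p ends u a₂ c b -
    prob p (PDEvent ends u a₂ c) * EQb3o p ends o u a₂ c b +
    Do p ends o u a₂ c * PDb p ends u a₂ c b - prob p (PDEvent ends u a₂ c) * PDbo p ends o u a₂ c b -
    gap p ends u a₂ b * Do p ends o u a₂ c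

/-- **The residual `X5`**: `Z·(d0·𝒟 + e0·ℰ) + ℋ·(Z·hb − gap)`, with `hb = P(a₂ ↔ b)`,
`d0 = P(a₂ ↮ c)`, `e0 = P(a₂ ↮ c, a₂ ↔ o)`. -/
noncomputable def X5 : R :=
  prob p (avoidAll ends a₂ {u}) *
      (prob p (avoidAll ends a₂ {c}) * Dd p ends o a₂ c b u +
        prob p (avoidAll ends a₂ {c} ∩ connEvent ends a₂ o) * Ee p ends a₂ c b u) +
    Hh p ends o a₂ c u *
      (prob p (avoidAll ends a₂ {u}) * prob p (connEvent ends a₂ b) - gap p ends u a₂ b)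

omit [Fintype V] [DecidableEq V] [LinearOrder R] [IsStrictOrderedRing R] in
/-- Euler in the first slot: `Gc(a₁ := u) = Z·𝒞 + gap·ℋ`. -/
theorem Gc_eq_Cc_Hh :
    Gc p ends o u a₂ c b =
      prob p (avoidAll ends a₂ {u}) * Cc p ends o a₂ c b u + gap p ends u a₂ b * Hh p ends o a₂ c u := by
  unfold Gc Cc Hh DEF
  ring

omit [Fintype V] [DecidableEq V] [LinearOrder R] [IsStrictOrderedRing R] in
/-- Euler in the second slot: `Gc(a₁ := u) = D·𝒟 + Do·ℰ`. -/
theorem Gc_eq_Dd_Ee :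
    Gc p ends o u a₂ c b =
      prob p (PDEvent ends u a₂ c) * Dd p ends o a₂ c b u + Do p ends o u a₂ c * Ee p ends a₂ c b u := by
  unfold Gc Dd Ee DEF
  ring

omit [Fintype V] [DecidableEq V] [LinearOrder R] [IsStrictOrderedRing R] in
/-- **The second coefficient in the atoms**: `T2 = 𝒞 + hb·ℋ + d0·𝒟 + e0·ℰ`. -/
theorem T2_eq_atoms :
    T2 p ends o a₂ c b u =
      prob p Set.univ * Cc p ends o a₂ c b u + prob p (connEvent ends a₂ b) * Hh p ends o a₂ c u +
        prob p (avoidAll ends a₂ {c}) * Dd p ends o a₂ c b u +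
        prob p (avoidAll ends a₂ {c} ∩ connEvent ends a₂ o) * Ee p ends a₂ c b u := by
  -- the four one-root splits by `{a₂ ↔ c}` (`P(X) = P(X, a₂ ↔ c) + P(X, a₂ ↮ c)`)
  have r1 : prob p (connEvent ends a₂ c ∩ connEvent ends a₂ b) =
      prob p (connEvent ends a₂ b) - prob p (avoidAll ends a₂ {c} ∩ connEvent ends a₂ b) := by
    have h := prob_inter_add_prob_inter_compl p (connEvent ends a₂ b) (connEvent ends a₂ c)
    rw [Set.inter_comm (connEvent ends a₂ b) (connEvent ends a₂ c),
      Set.inter_comm (connEvent ends a₂ b) (connEvent ends a₂ c)ᶜ,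
      ← avoidAll_singleton_eq ends a₂ c] at h
    linear_combination h
  have r2 : prob p (connEvent ends a₂ c ∩ (connEvent ends a₂ o ∩ connEvent ends a₂ b)) =
      prob p (connEvent ends a₂ o ∩ connEvent ends a₂ b) -
        prob p (avoidAll ends a₂ {c} ∩ (connEvent ends a₂ o ∩ connEvent ends a₂ b)) := by
    have h := prob_inter_add_prob_inter_compl p (connEvent ends a₂ o ∩ connEvent ends a₂ b)
      (connEvent ends a₂ c)
    rw [Set.inter_comm (connEvent ends a₂ o ∩ connEvent ends a₂ b) (connEvent ends a₂ c),
      Set.inter_comm (connEvent ends a₂ o ∩ connEvent ends a₂ b) (connEvent ends a₂ c)ᶜ,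
      ← avoidAll_singleton_eq ends a₂ c] at h
    linear_combination h
  have r3 : prob p (connEvent ends a₂ c) = prob p Set.univ - prob p (avoidAll ends a₂ {c}) := by
    have h := prob_inter_add_prob_inter_compl p Set.univ (connEvent ends a₂ c)
    simp only [Set.univ_inter] at h
    rw [← avoidAll_singleton_eq ends a₂ c] at h
    linear_combination h
  have r4 : prob p (connEvent ends a₂ c ∩ connEvent ends a₂ o) =
      prob p (connEvent ends a₂ o) - prob p (avoidAll ends a₂ {c} ∩ connEvent ends a₂ o) := by
    have h := prob_inter_add_prob_inter_compl p (connEvent ends a₂ o) (connEvent ends a₂ c)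
    rw [Set.inter_comm (connEvent ends a₂ o) (connEvent ends a₂ c),
      Set.inter_comm (connEvent ends a₂ o) (connEvent ends a₂ c)ᶜ,
      ← avoidAll_singleton_eq ends a₂ c] at h
    linear_combination h
  unfold T2 Cc Hh Dd Ee DEF
  rw [r1, r2, r3, r4]
  ring

omit [Fintype V] [DecidableEq V] [LinearOrder R] [IsStrictOrderedRing R] in
/-- **`Z·T2 = Gc(a₁ := u) + X5`** — the induction term split off the second coefficient. -/
theorem Z_mul_T2_eq :
    prob p (avoidAll ends a₂ {u}) * T2 p ends o a₂ c b u =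
      Gc p ends o u a₂ c b + X5 p ends o a₂ c b u := by
  rw [T2_eq_atoms, Gc_eq_Cc_Hh, prob_univ]
  unfold X5
  ring

end Atoms

section Signs

variable (p : E → R) (ends : E → Sym2 V) (o a₂ c b u : V)

omit [Fintype V] [DecidableEq V] [LinearOrder R] [IsStrictOrderedRing R] in
/-- `DEF` changes sign under the root swap. -/
lemma DEF_root_swap : DEF p ends o a₂ u c = -DEF p ends o u a₂ c := by
  unfold DEF EQo EQ3 EQ3o Do
  rw [avoidAll_root_swap, PDEvent_root_swap]
  ring

omit [Fintype V] [DecidableEq V] [LinearOrder R] [IsStrictOrderedRing R] in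
/-- `Do` is symmetric under the root swap. -/
lemma Do_root_swap : Do p ends o a₂ u c = Do p ends o u a₂ c := by
  unfold Do
  rw [PDEvent_root_swap]
  ring

/-- **`0 ≤ ℋ`**: `ℋ` is the cleared margin of the root-swapped instance (`margin_nonneg`). -/
theorem Hh_nonneg (hp : IsProbVec p) : 0 ≤ Hh p ends o a₂ c u := by
  have h := margin_nonneg p hp ends o a₂ u c
  unfold marginC at h
  rw [DEF_root_swap, Do_root_swap, avoidAll_root_swap] at h
  unfold Hh
  linarith

omit [Fintype E] [DecidableEq E] [Fintype V] [DecidableEq V] in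
/-- `T′ = {c ∈ C(u), u ↮ a₂}` (the cluster-of-`u` side of `T`). -/
lemma TEvent_a2u_eq : TEvent ends a₂ u c = connEvent ends u c ∩ (connEvent ends u a₂)ᶜ := by
  unfold TEvent
  exact Set.inter_comm _ _

omit [Fintype E] [DecidableEq E] [Fintype V] [DecidableEq V] in
/-- `T′ ∩ {u ↔ b}` in the form of BHK06 Thm 1.3 at the root `u`. -/
lemma TEvent_a2u_inter_ub_eq :
    TEvent ends a₂ u c ∩ connEvent ends u b =
      connEvent ends u b ∩ connEvent ends u c ∩ (connEvent ends u a₂)ᶜ := by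
  unfold TEvent
  ext ω
  simp only [Set.mem_inter_iff, Set.mem_compl_iff]
  tauto

omit [Fintype E] [DecidableEq E] [Fintype V] [DecidableEq V] in
/-- `Q ∩ {u ↔ b}` in the form of BHK06 Thm 1.3 at the root `u`. -/
lemma Q_inter_ub_eq :
    avoidAll ends a₂ {u} ∩ connEvent ends u b = connEvent ends u b ∩ (connEvent ends u a₂)ᶜ := by
  rw [avoidAll_singleton_eq, connEvent_comm ends a₂ u]
  exact Set.inter_comm _ _

omit [Fintype E] [DecidableEq E] [Fintype V] [DecidableEq V] in
/-- `Q` in the form of BHK06 Thm 1.3 at the root `u`. -/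
lemma Q_eq_compl_ua2 : avoidAll ends a₂ {u} = (connEvent ends u a₂)ᶜ := by
  rw [avoidAll_singleton_eq, connEvent_comm ends a₂ u]

omit [Fintype E] [DecidableEq E] [Fintype V] [DecidableEq V] in
/-- `T′ ∩ {a₂ ↔ b}` in the form of BHK06 Thm 1.4 (`s = a₂`, `t = u`). -/
lemma TEvent_a2u_inter_a2b_eq :
    TEvent ends a₂ u c ∩ connEvent ends a₂ b =
      connEvent ends a₂ b ∩ connEvent ends u c ∩ (connEvent ends a₂ u)ᶜ := by
  unfold TEvent
  rw [connEvent_comm ends u a₂]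
  ext ω
  simp only [Set.mem_inter_iff, Set.mem_compl_iff]
  tauto

omit [Fintype E] [DecidableEq E] [Fintype V] [DecidableEq V] in
/-- `T′` in the form of BHK06 Thm 1.4 (`s = a₂`, `t = u`). -/
lemma TEvent_a2u_eq' : TEvent ends a₂ u c = connEvent ends u c ∩ (connEvent ends a₂ u)ᶜ := by
  unfold TEvent
  rw [connEvent_comm ends u a₂]
  exact Set.inter_comm _ _

omit [Fintype E] [DecidableEq E] [Fintype V] [DecidableEq V] in
/-- `Q ∩ {a₂ ↔ b}` in the form of BHK06 Thm 1.4 (`s = a₂`, `t = u`). -/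
lemma Q_inter_a2b_eq :
    avoidAll ends a₂ {u} ∩ connEvent ends a₂ b = connEvent ends a₂ b ∩ (connEvent ends a₂ u)ᶜ := by
  rw [avoidAll_singleton_eq]
  exact Set.inter_comm _ _

omit [Fintype V] in
/-- **`ℰ` as two BHK slacks and a mass**:
`ℰ = 2·[Z·P(T′, b ∈ L) − P(Q, b ∈ L)·P(T′)] + 2·[P(Q, b ∈ K)·P(T′) − Z·P(T′, b ∈ K)] + 2·Z·P(PD, b ∈ L)`. -/
theorem Ee_eq :
    Ee p ends a₂ c b u =
      2 * (prob p (avoidAll ends a₂ {u}) * prob p (TEvent ends a₂ u c ∩ connEvent ends u b) -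
          prob p (avoidAll ends a₂ {u} ∩ connEvent ends u b) * prob p (TEvent ends a₂ u c)) +
        2 * (prob p (avoidAll ends a₂ {u} ∩ connEvent ends a₂ b) * prob p (TEvent ends a₂ u c) -
          prob p (avoidAll ends a₂ {u}) * prob p (TEvent ends a₂ u c ∩ connEvent ends a₂ b)) +
        2 * prob p (avoidAll ends a₂ {u}) * prob p (PDEvent ends u a₂ c ∩ connEvent ends u b) := by
  unfold Ee EQb3 PDb EQ3
  rw [gap_eq_Q, Qsplit p ends u a₂ c (connEvent ends u b), Qsplit p ends u a₂ c (connEvent ends a₂ b),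
    Qsplit_univ p ends u a₂ c]
  ring

/-- **`0 ≤ ℰ`**: BHK06 Thm 1.3 (same cluster `C(u)`, avoiding `a₂`) and Thm 1.4 (cross cluster),
plus the mass `Z·P(PD, b ∈ L)`. -/
theorem Ee_nonneg (hp : IsProbVec p) : 0 ≤ Ee p ends a₂ c b u := by
  rw [Ee_eq]
  -- BHK 1.3 at the root `u`: `P(Q, bL)·P(T′) ≤ P(T′, bL)·Z`
  have h13 := bhk_same_cluster_events p hp ends u a₂ (ExploreA3.isUpperSet_mem b)
    (ExploreA3.isUpperSet_mem c)
  simp only [ExploreA3.clusterInEvent_mem_eq] at h13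
  rw [← TEvent_a2u_inter_ub_eq ends a₂ c b u, ← TEvent_a2u_eq ends a₂ c u, ← Q_inter_ub_eq ends a₂ b u,
    ← Q_eq_compl_ua2 ends a₂ u] at h13
  -- BHK 1.4 (`s = a₂`, `t = u`): `P(T′, bK)·Z ≤ P(Q, bK)·P(T′)`
  have h14 := bhk_cross_cluster p hp ends a₂ u (ExploreA3.isUpperSet_mem b)
    (ExploreA3.isUpperSet_mem c)
  simp only [ExploreA3.clusterInEvent_mem_eq] at h14
  rw [← TEvent_a2u_inter_a2b_eq ends a₂ c b u, ← Q_inter_a2b_eq ends a₂ b u, ← TEvent_a2u_eq' ends a₂ c u,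
    ← avoidAll_singleton_eq ends a₂ u] at h14
  have hm : 0 ≤ prob p (avoidAll ends a₂ {u}) * prob p (PDEvent ends u a₂ c ∩ connEvent ends u b) :=
    mul_nonneg (prob_nonneg hp _) (prob_nonneg hp _)
  linarith [h13, h14, hm]

omit [Fintype V] [DecidableEq V] in
/-- **`0 ≤ Z·hb − gap`**: Harris (`Q` decreasing, `{a₂ ↔ b}` increasing) and the mass `P(Q, u ↔ b)`. -/
theorem Zhb_sub_gap_nonneg (hp : IsProbVec p) :
    0 ≤ prob p (avoidAll ends a₂ {u}) * prob p (connEvent ends a₂ b) - gap p ends u a₂ b := by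
  rw [gap_eq_Q]
  have hQ : IsLowerSet (avoidAll ends a₂ {u}) := by
    rw [avoidAll_singleton_eq]
    exact (isUpperSet_connEvent ends a₂ u).compl
  have h := prob_inter_le_prob_mul_prob_of_isLowerSet hp hQ (isUpperSet_connEvent ends a₂ b)
  have h0 := prob_nonneg hp (avoidAll ends a₂ {u} ∩ connEvent ends u b)
  linarith

end Signs

section Degenerate

variable (p : E → R) (ends : E → Sym2 V) (o a₂ c b u : V)

omit [Fintype E] [DecidableEq E] [Fintype V] [DecidableEq V] in
/-- `T ⊆ Q`. -/
lemma TEvent_ua2_subset_Q : TEvent ends u a₂ c ⊆ avoidAll ends a₂ {u} := by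
  rw [avoidAll_singleton_eq]
  exact Set.inter_subset_left

omit [Fintype E] [DecidableEq E] [Fintype V] [DecidableEq V] in
/-- `T′ ⊆ Q`. -/
lemma TEvent_a2u_subset_Q : TEvent ends a₂ u c ⊆ avoidAll ends a₂ {u} := by
  rw [Q_eq_compl_ua2]
  exact Set.inter_subset_left

omit [Fintype E] [DecidableEq E] [Fintype V] [DecidableEq V] in
/-- `PD ⊆ Q`. -/
lemma PDEvent_subset_Q : PDEvent ends u a₂ c ⊆ avoidAll ends a₂ {u} := by
  rw [Q_eq_compl_ua2]
  exact Set.inter_subset_left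

omit [Fintype V] [DecidableEq V] in
/-- **The degenerate case `P(Q) = 0`**: every mass of the instance `a₁ := u` vanishes, so `T2 = 0`. -/
theorem T2_eq_zero_of_Z_eq_zero (hp : IsProbVec p) (hZ : prob p (avoidAll ends a₂ {u}) = 0) :
    T2 p ends o a₂ c b u = 0 := by
  have hsub : ∀ X : Set (Config E), X ⊆ avoidAll ends a₂ {u} → prob p X = 0 := fun X hX =>
    le_antisymm (hZ ▸ prob_mono hp hX) (prob_nonneg hp X)
  have h0 : ∀ B : Set (Config E), prob p (avoidAll ends a₂ {u} ∩ B) = 0 := fun B =>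
    hsub _ Set.inter_subset_left
  have hT : ∀ B : Set (Config E), prob p (TEvent ends u a₂ c ∩ B) = 0 := fun B =>
    hsub _ (Set.inter_subset_left.trans (TEvent_ua2_subset_Q ends a₂ c u))
  have hT' : ∀ B : Set (Config E), prob p (TEvent ends a₂ u c ∩ B) = 0 := fun B =>
    hsub _ (Set.inter_subset_left.trans (TEvent_a2u_subset_Q ends a₂ c u))
  have hPD : ∀ B : Set (Config E), prob p (PDEvent ends u a₂ c ∩ B) = 0 := fun B =>
    hsub _ (Set.inter_subset_left.trans (PDEvent_subset_Q ends a₂ c u))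
  have hPD0 : prob p (PDEvent ends u a₂ c) = 0 := hsub _ (PDEvent_subset_Q ends a₂ c u)
  have hT0 : prob p (TEvent ends u a₂ c) = 0 := hsub _ (TEvent_ua2_subset_Q ends a₂ c u)
  have hT0' : prob p (TEvent ends a₂ u c) = 0 := hsub _ (TEvent_a2u_subset_Q ends a₂ c u)
  unfold T2 EQbo EQb3 EQb3o EQo EQ3 EQ3o PDb PDbo Do
  rw [gap_eq_Q]
  simp only [h0, hT, hT', hPD, hPD0, hT0, hT0', hZ]
  ring

end Degenerate

section Main

variable (p : E → R) (ends : E → Sym2 V) (o a₂ c b u : V)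

omit [Fintype V] [DecidableEq V] in
/-- **`0 ≤ T2` from `0 ≤ X5` and (HCOV) at `a₁ := u`** (both cases of `P(Q)`). -/
theorem T2_nonneg_of_X5 (hp : IsProbVec p) (hX : 0 ≤ X5 p ends o a₂ c b u)
    (h3 : HCov p ends o u a₂ c b) : 0 ≤ T2 p ends o a₂ c b u := by
  rcases (prob_nonneg hp (avoidAll ends a₂ {u})).lt_or_eq with hZ | hZ
  · have h := Z_mul_T2_eq p ends o a₂ c b u
    unfold HCov at h3
    have hprod : 0 ≤ prob p (avoidAll ends a₂ {u}) * T2 p ends o a₂ c b u := by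
      rw [h]
      exact add_nonneg h3 hX
    exact (mul_nonneg_iff_of_pos_left hZ).1 hprod
  · rw [T2_eq_zero_of_Z_eq_zero p ends o a₂ c b u hp hZ.symm]

omit [Fintype V] [DecidableEq V] in
/-- **The coefficientwise (THIN)**: `Gc(a₁ := u) ≤ T2` from `0 ≤ X5` and (HCOV) at `a₁ := u`. -/
theorem Gc_le_T2_of_X5 (hp : IsProbVec p) (hX : 0 ≤ X5 p ends o a₂ c b u)
    (h3 : HCov p ends o u a₂ c b) : Gc p ends o u a₂ c b ≤ T2 p ends o a₂ c b u := by
  have hT2 := T2_nonneg_of_X5 p ends o a₂ c b u hp hX h3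
  have h := Z_mul_T2_eq p ends o a₂ c b u
  have hZ1 : prob p (avoidAll ends a₂ {u}) ≤ 1 := prob_le_one hp _
  have hZ0 : 0 ≤ prob p (avoidAll ends a₂ {u}) := prob_nonneg hp _
  nlinarith [h, hX, hT2, hZ1, hZ0]

/-- **(HCOV) for a root leaf at an unmarked vertex, modulo `0 ≤ X5`**: the class (G4-u) reduced to
the sign of the residual `X5` (no induction term inside) and (HCOV) at `a₁ := u`. -/
theorem HCov_root_leaf_u_of_X5 (hp : IsProbVec p) {f : E} {a₁ : V} (hf : ends f = s(a₁, u))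
    (hleaf : ∀ e, a₁ ∈ ends e → e = f) (h1u : a₁ ≠ u) (h12 : a₁ ≠ a₂)
    (h1c : a₁ ≠ c) (h1o : a₁ ≠ o) (h1b : a₁ ≠ b) (hX : 0 ≤ X5 p ends o a₂ c b u)
    (h3 : HCov p ends o u a₂ c b) : HCov p ends o a₁ a₂ c b :=
  HCov_root_leaf_u_of p ends hp hf hleaf h1u h12 h1c h1o h1b
    (T2_nonneg_of_X5 p ends o a₂ c b u hp hX h3) h3

end Main

end RootLeafU

end Summit.Ventures.PercRepro2
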